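import Summits.CriticalPhenomena.PercolationContinuityZ3.Theorems.SahiMasterFamilyThreePartitionMaxClass25CertA
import Summits.CriticalPhenomena.PercolationContinuityZ3.Theorems.SahiMasterFamilyThreePartitionMaxClass25CertB
import HarnessLib

/-!
# The step of the maximal product class {011,122}ᶜ (25 of 27 types — the largest) (all types except 011, 122) for twisted three-partition positivity
# (unit `prim-master-conj`, gen 34; `--supports stmt-CriticalPhenomena-4575`)

Memo `run/shared/lean/prim/prim-l12/prim-master-conj/POINTWISE.md` §35.6.  If at the coordinate `e` the triple of up-sets `(𝒰, 𝒱, 𝒲)` realises only types of the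
class — in section language: (i) `(𝒱¹ ∩ 𝒲¹) ∖ 𝒰¹ ⊆ 𝒱⁰ ∪ 𝒲⁰` and (ii) `𝒰¹ ∩ 𝒱⁰ ∩ 𝒲⁰ ⊆ 𝒰⁰` — and the listed `e`-free threshold-section triples have `N_τ ≥ 0`, then `threePartNT τ 𝒰 𝒱 𝒲 ≥ 0`
(`threePartNT_nonneg_of_xa0`, realised-type hypothesis `hreal : ∀ w, inM 134086639 (typ 𝒰 𝒱 𝒲 e w) = true`; mask values listed by `xa_mask_iff`).
Certificates of `…MaxClass25CertA/B` (LP kit j208583, exactified; kernel-checked).  No `sorry`, standard axioms, nothing conditional beyond the displayed IH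
hypotheses.  HONEST LABEL: a class STEP, not three-partition positivity. [this work]
-/

noncomputable section

open Finset
open scoped symmDiff Classical

namespace Summit.CriticalPhenomena.PercolationContinuityZ3.Theorems.ThreePartition

namespace TypedSlice

section MaxClass25Main

variable {ι : Type*} [Fintype ι] {𝒰 𝒱 𝒲 : Set (Set ι)} (e : ι) (τ : Set ι)

/-- **Product-class step `xa0`**: if at `e` the triple realises only types of the class (mask `134086639`; `hreal`) and the listed
`e`-free threshold triples have nonnegative twisted functional, then `threePartNT τ 𝒰 𝒱 𝒲 ≥ 0` (LP certificates of gen 34,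
kit j208583, exactified; kernel-checked). [this work] -/
theorem threePartNT_nonneg_of_xa0 (h𝒰 : IsUpperSet 𝒰) (h𝒱 : IsUpperSet 𝒱) (h𝒲 : IsUpperSet 𝒲)
    (hreal : ∀ w : Set ι, inM 134086639 (typ 𝒰 𝒱 𝒲 e w) = true)
    (hN1 : 0 ≤ threePartNT τ (thrSet 𝒰 𝒱 𝒲 e (mk 0 0 1)) (thrSet 𝒰 𝒱 𝒲 e (mk 0 2 0)) (thrSet 𝒰 𝒱 𝒲 e (mk 1 0 0)))
    (hN2 : 0 ≤ threePartNT τ (thrSet 𝒰 𝒱 𝒲 e (mk 0 0 2)) (thrSet 𝒰 𝒱 𝒲 e (mk 0 1 0)) (thrSet 𝒰 𝒱 𝒲 e (mk 1 0 0)))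
    (hN3 : 0 ≤ threePartNT τ (thrSet 𝒰 𝒱 𝒲 e (mk 0 0 2)) (thrSet 𝒰 𝒱 𝒲 e (mk 0 2 0)) (thrSet 𝒰 𝒱 𝒲 e (mk 2 0 0)))
    (hN4 : 0 ≤ threePartNT τ (thrSet 𝒰 𝒱 𝒲 e (mk 0 0 1)) (thrSet 𝒰 𝒱 𝒲 e (mk 0 1 0)) (thrSet 𝒰 𝒱 𝒲 e (mk 1 0 0))) :
    0 ≤ threePartNT τ 𝒰 𝒱 𝒲 := by
  by_cases he : e ∈ τ
  · refine threePartNT_nonneg_of_cert 𝒰 𝒱 𝒲 e τ h𝒰 h𝒱 h𝒲 (d := 1) (by norm_num) (L := xa0BL) (I := xa0BI)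
      (cls := inM 134086639) xa0B_ok ?_ hreal ?_
    · rw [decide_eq_true he]; exact xa0B_check
    · intro p hp
      simp only [xa0BI, List.mem_cons, List.not_mem_nil, or_false] at hp
      rcases hp with rfl | rfl | rfl
      · exact hN4
      · exact hN1
      · exact hN2
  · refine threePartNT_nonneg_of_cert 𝒰 𝒱 𝒲 e τ h𝒰 h𝒱 h𝒲 (d := 1) (by norm_num) (L := xa0AL) (I := xa0AI)
      (cls := inM 134086639) xa0A_ok ?_ hreal ?_
    · rw [decide_eq_false he]; exact xa0A_check
    · intro p hp
      simp only [xa0AI, List.mem_cons, List.not_mem_nil, or_false] at hp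
      rcases hp with rfl | rfl | rfl
      · exact hN1
      · exact hN2
      · exact hN3



/-- The 27 values of the class mask. [this work] -/
theorem xa_mask_iff (t : Ty) : inM 134086639 t = true ↔ ¬ (t = mk 0 1 1 ∨ t = mk 1 2 2) := by
  revert t; decide

omit [Fintype ι] in
/-- Under the two structural conditions every realised type is in the class `{011, 122}ᶜ`. [this work] -/
theorem xa_real (h𝒰 : IsUpperSet 𝒰) (h𝒱 : IsUpperSet 𝒱) (h𝒲 : IsUpperSet 𝒲)
    (h011 : ∀ T : Set ι, insert e T ∈ 𝒱 → insert e T ∈ 𝒲 → insert e T ∉ 𝒰 → (T \ {e} ∈ 𝒱 ∨ T \ {e} ∈ 𝒲))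
    (h122 : ∀ T : Set ι, insert e T ∈ 𝒰 → T \ {e} ∈ 𝒱 → T \ {e} ∈ 𝒲 → T \ {e} ∈ 𝒰) (w : Set ι) :
    inM 134086639 (typ 𝒰 𝒱 𝒲 e w) = true := by
  rw [xa_mask_iff]
  have h2U := tyAt_eq_two_iff 𝒰 e w
  have h2V := tyAt_eq_two_iff 𝒱 e w
  have h2W := tyAt_eq_two_iff 𝒲 e w
  have h1U := one_le_tyAt_iff h𝒰 e w
  have h1V := one_le_tyAt_iff h𝒱 e w
  have h1W := one_le_tyAt_iff h𝒲 e w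
  rintro (h | h) <;> simp only [typ, mk, Prod.mk.injEq] at h <;> obtain ⟨ha, hb, hc⟩ := h
  · have hV1 : insert e w ∈ 𝒱 := h1V.1 (by rw [hb])
    have hW1 : insert e w ∈ 𝒲 := h1W.1 (by rw [hc])
    have hU1 : insert e w ∉ 𝒰 := fun h => by have := h1U.2 h; rw [ha] at this; exact absurd this (by decide)
    rcases h011 w hV1 hW1 hU1 with h0 | h0
    · have := h2V.2 h0; rw [hb] at this; exact absurd this (by decide)
    · have := h2W.2 h0; rw [hc] at this; exact absurd this (by decide)
  · have hU1 : insert e w ∈ 𝒰 := h1U.1 (by rw [ha])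
    have := h2U.2 (h122 w hU1 (h2V.1 hb) (h2W.1 hc)); rw [ha] at this; exact absurd this (by decide)

/-- **The `{011,122}ᶜ` step** (the largest certifiable product class, 25 of 27 types): if at `e`
(i) every set whose `e`-augmentation lies in `𝒱` and `𝒲` but not in `𝒰` has its `e`-deletion in `𝒱` or in `𝒲`, and
(ii) `𝒰¹ ∩ 𝒱⁰ ∩ 𝒲⁰ ⊆ 𝒰⁰`, and the listed `e`-free needs hold, then `threePartNT τ 𝒰 𝒱 𝒲 ≥ 0`. [this work] -/
theorem threePartNT_nonneg_of_maxClass25 (h𝒰 : IsUpperSet 𝒰) (h𝒱 : IsUpperSet 𝒱) (h𝒲 : IsUpperSet 𝒲)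
    (h011 : ∀ T : Set ι, insert e T ∈ 𝒱 → insert e T ∈ 𝒲 → insert e T ∉ 𝒰 → (T \ {e} ∈ 𝒱 ∨ T \ {e} ∈ 𝒲))
    (h122 : ∀ T : Set ι, insert e T ∈ 𝒰 → T \ {e} ∈ 𝒱 → T \ {e} ∈ 𝒲 → T \ {e} ∈ 𝒰)
    (hN1 : 0 ≤ threePartNT τ (thrSet 𝒰 𝒱 𝒲 e (mk 0 0 1)) (thrSet 𝒰 𝒱 𝒲 e (mk 0 2 0)) (thrSet 𝒰 𝒱 𝒲 e (mk 1 0 0)))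
    (hN2 : 0 ≤ threePartNT τ (thrSet 𝒰 𝒱 𝒲 e (mk 0 0 2)) (thrSet 𝒰 𝒱 𝒲 e (mk 0 1 0)) (thrSet 𝒰 𝒱 𝒲 e (mk 1 0 0)))
    (hN3 : 0 ≤ threePartNT τ (thrSet 𝒰 𝒱 𝒲 e (mk 0 0 2)) (thrSet 𝒰 𝒱 𝒲 e (mk 0 2 0)) (thrSet 𝒰 𝒱 𝒲 e (mk 2 0 0)))
    (hN4 : 0 ≤ threePartNT τ (thrSet 𝒰 𝒱 𝒲 e (mk 0 0 1)) (thrSet 𝒰 𝒱 𝒲 e (mk 0 1 0)) (thrSet 𝒰 𝒱 𝒲 e (mk 1 0 0))) :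
    0 ≤ threePartNT τ 𝒰 𝒱 𝒲 :=
  threePartNT_nonneg_of_xa0 e τ h𝒰 h𝒱 h𝒲 (xa_real e h𝒰 h𝒱 h𝒲 h011 h122) hN1 hN2 hN3 hN4

end MaxClass25Main

end TypedSlice

end Summit.CriticalPhenomena.PercolationContinuityZ3.Theorems.ThreePartition
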